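import Summits.ValiantsHypothesis.ValiantsHypothesis.Theorems.KPlusLogSqLawTropicalBTowerRowTwoGenIds

/-!
# ★ THE GENERAL `m = 2` TROPICAL OPTIMUM `T(2, K) = 4K − 7` IS ATTAINED ON EVERY 2-TOWER (off-chain transpositions; assembly)

Crux `TropicalB` (stmt-ValiantsHypothesis-19771) calibration, companion of the symmetric tower design `…TowerGraftTowerRowTwoSym`
(`3K − 4`, crux `WeakLifting` 19561): the tree's exact GENERAL row `T(2, K) = 4K − 7` (`TwoRowFamily.tropRootLawAt_two_iff`, witnessed on the
near-arithmetic support `4K²·l + l²`) is ATTAINED ON EVERY 2-TOWER.  NO stub is claimed; nothing on `TropicalB` in its window, `WeakLifting`,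
`MatrixDescartes` (18050) or `VP ≠ VNP`.  Seat: prover leafhand-val-kpluslogsqlaw-1 g3, `--supports stmt-ValiantsHypothesis-19771`.

* `off_swapg`, `off_chaing` — the remaining off-chain terms (transpositions `(i, j)`, `1 ≤ i ≤ K−3`, `2 ≤ j ≤ K−2`) lie above a chord; every
  present off-chain term is covered (with `…TowerRowTwoGenIds`);
* ★ `exists_chain` — on every 2-tower `d` with `K ≥ 3` letters, a `2 × 2` dominance design ON `d` with `4K − 7` sign-alternating uniquely dominant
  breakpoints (envelope criterion `EnvelopeCriterion.isDominant_of_envelope`, p817916);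
* `exists_pencil_card_ge` — Viro patchworking (`le_card_posRoots_patch`): a real (not necessarily symmetric) `2 × 2` pencil on `d` with at least
  `4K − 7` distinct positive determinant zeros;
* `not_tropRow_below_on_tower` — the support-level tropical row on the tower refutes every budget `< 4K − 7`.

So towers — the most constrained chambers (lex order of pair sums) — are EXTREMAL for the general `m = 2` tropical row (`tropRootLawAt_two_sharp`:
`≤ 4K − 7` on every support), as they are for the symmetric row (`3K − 4`, `…TowerRowTwoSym`).  HONEST FRAMING: calibration of the
tropical census at `m = 2`; nothing on `TropicalB`'s window, `Lifting`/`WeakLifting`, `MatrixDescartes` or `VP ≠ VNP`.  Def-free.  [this work]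
-/

set_option linter.dupNamespace false
set_option autoImplicit false

namespace Summit.ValiantsHypothesis.ValiantsHypothesis.Theorems.KPlusLogSqLaw.TowerGraft

open Summit.ValiantsHypothesis.ValiantsHypothesis.Theorems.MatrixDescartes.Negative
open Summit.ValiantsHypothesis.ValiantsHypothesis.Theorems.LacunarySymmetroidMatrixDescartes
open Summit.ValiantsHypothesis.ValiantsHypothesis.Theorems.LacunarySymmetroidMatrixDescartes.TropicalCensus
open Summit.ValiantsHypothesis.ValiantsHypothesis.Theorems.KPlusLogSqLaw.EnvelopeCriterion
open Summit.ValiantsHypothesis.ValiantsHypothesis.Theorems.KPlusLogSqLaw.TwoRowFamily (perm_two)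
open Finset

namespace TowerRowTwoGen

open TowerRowTwoSym (dN dN_lt dN_tower dN_le dN_nonneg slope_two)

variable {K : ℕ}

section offchain
variable (hK : 3 ≤ K) {d : Fin K → ℕ} (hd : ∀ l l' : Fin K, l < l' → 2 * d l < d l')
include hK hd

/-- transposition terms off the chain path: classes `(i, j)` with `1 ≤ i ≤ K − 3`, `2 ≤ j ≤ K − 2`. -/
theorem off_swapg (i j : ℕ) (hi1 : 1 ≤ i) (hi : i + 3 ≤ K) (hj2 : 2 ≤ j) (hjK : j + 2 ≤ K)
    (q : Equiv.Perm (Fin 2) × (Fin 2 → Fin K)) (hq : q.1 = Equiv.swap 0 1) (hq0 : ((q.2 0 : Fin K) : ℕ) = i)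
    (hq1 : ((q.2 1 : Fin K) : ℕ) = j) :
    ∃ jj : Fin (4 * K - 7), (fun k : Fin (4 * K - 7 + 1) => Xg K d k) jj.castSucc ≤ TropicalCensus.slope d q ∧
      TropicalCensus.slope d q ≤ (fun k : Fin (4 * K - 7 + 1) => Xg K d k) jj.succ ∧
      (fun k : Fin (4 * K - 7 + 1) => Cg K d k) jj.castSucc +
        (fun k : Fin (4 * K - 7 + 1) => (4 : ℤ) ^ (k : ℕ)) jj.succ *
          (TropicalCensus.slope d q - (fun k : Fin (4 * K - 7 + 1) => Xg K d k) jj.castSucc) <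
        ∑ i, vg K d (q.1 i) i (q.2 i) := by
  have hs : TropicalCensus.slope d q = dN K d i + dN K d j := by rw [TowerRowTwoSym.slope_two, hq0, hq1]
  have hc : ∑ i, vg K d (q.1 i) i (q.2 i) = bG K d i + eG K d j := by rw [costg_swap d q hq, hq0, hq1]
  -- the late climb of `bG`: `4^{3K−5}(d_i − d₀) ≤ bG i`
  have hb : 4 ^ (3 * K - 6 + 1) * (dN K d i - dN K d 0) ≤ bG K d i := by
    have h := le_Cg_sub hd hK (show 3 * K - 6 ≤ 3 * K - 6 + i by omega) (by omega)
    rw [Xlate hK d hi, show 3 * K - 6 = 3 * K - 6 + 0 from rfl, Xlate hK d (by omega)] at h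
    unfold bG; simpa using h
  have hi0 : 0 < dN K d i - dN K d 0 := by have := dN_lt hd (show 0 < i by omega) (by omega); linarith
  have h00 := dN_nonneg (K := K) (d := d) 0
  rcases lt_trichotomy i j with hij | rfl | hji
  · -- i < j: interval 3j − 3
    refine chord_witnessg q (3 * j - 3) (by omega) ?_ ?_ ?_
    · rw [hs, Xsw d hj2 hjK]; linarith
    · rw [hs, show 3 * j - 3 + 1 = 3 * j - 2 by omega, Xid1 d (by omega) hjK]
      have := dN_le hd (show i ≤ j - 1 by omega) (by omega); linarith
    · rw [hs, hc, Xsw d hj2 hjK, show 3 * j - 3 + 1 = 3 * j - 2 by omega]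
      unfold eG
      have hpow : (4 : ℤ) ^ (3 * j - 2) < 4 ^ (3 * K - 6 + 1) := pow_lt_pow_right₀ (by norm_num) (by omega)
      nlinarith [mul_lt_mul_of_pos_right hpow hi0]
  · -- i = j: twin of the chain identity term (i, i); interval 3i − 2, right endpoint
    have hsX : TropicalCensus.slope d q = Xg K d (3 * i - 2 + 1) := by
      rw [hs, show 3 * i - 2 + 1 = 3 * i - 1 by omega, Xid2 d (by omega) hjK]
    refine chord_witnessg q (3 * i - 2) (by omega) ?_ (le_of_eq hsX) ?_
    · rw [hsX]; exact (Xg_lt_succ hd hK (by omega)).le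
    · rw [hsX, ← Cg_succ, hc, show 3 * i - 2 + 1 = 3 * i - 1 by omega]
      unfold eG
      have hup := Cg_sub_le hd hK (show 3 * i - 3 ≤ 3 * i - 1 by omega) (by omega)
      rw [Xid2 d (by omega) hjK, Xsw d hj2 hjK] at hup
      have hpow : (4 : ℤ) ^ (3 * i - 1) < 4 ^ (3 * K - 6 + 1) := pow_lt_pow_right₀ (by norm_num) (by omega)
      nlinarith [mul_lt_mul_of_pos_right hpow hi0]
  · -- i > j: interval 3i − 3
    have hi2 : 2 ≤ i := by omega
    have hiK2 : i + 2 ≤ K := by omega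
    refine chord_witnessg q (3 * i - 3) (by omega) ?_ ?_ ?_
    · rw [hs, Xsw d hi2 hiK2]
      have := dN_le hd (Nat.zero_le j) (by omega); linarith
    · rw [hs, show 3 * i - 3 + 1 = 3 * i - 2 by omega, Xid1 d (by omega) hiK2]
      have := dN_le hd (show j ≤ i - 1 by omega) (by omega); linarith
    · rw [hs, hc, Xsw d hi2 hiK2, show 3 * i - 3 + 1 = 3 * i - 2 by omega]
      unfold eG
      have hup := Cg_sub_le hd hK (show 3 * j - 3 ≤ 3 * i - 3 by omega) (by omega)
      rw [Xsw d hi2 hiK2, Xsw d hj2 hjK] at hup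
      have hpow : (4 : ℤ) ^ (3 * i - 2) < 4 ^ (3 * K - 6 + 1) := pow_lt_pow_right₀ (by norm_num) (by omega)
      have hpow' : (4 : ℤ) ^ (3 * i - 3) ≤ 4 ^ (3 * i - 2) := pow_le_pow_right₀ (by norm_num) (by omega)
      have hij0 : 0 ≤ dN K d i - dN K d j := by have := dN_lt hd hji (by omega); linarith
      have hj0 : 0 ≤ dN K d j - dN K d 0 := by have := dN_le hd (Nat.zero_le j) (by omega); linarith
      nlinarith [mul_lt_mul_of_pos_right hpow hi0, mul_le_mul_of_nonneg_right hpow' hij0]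

/-- **every present off-chain term lies strictly above a chord of the chain.** -/
theorem off_chaing (q : Equiv.Perm (Fin 2) × (Fin 2 → Fin K)) (hq : termSign (εg K) q ≠ 0)
    (hch : ∀ k, q ≠ termg K hK k) :
    ∃ j : Fin (4 * K - 7), (fun k : Fin (4 * K - 7 + 1) => Xg K d k) j.castSucc ≤ TropicalCensus.slope d q ∧
      TropicalCensus.slope d q ≤ (fun k : Fin (4 * K - 7 + 1) => Xg K d k) j.succ ∧
      (fun k : Fin (4 * K - 7 + 1) => Cg K d k) j.castSucc +
        (fun k : Fin (4 * K - 7 + 1) => (4 : ℤ) ^ (k : ℕ)) j.succ *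
          (TropicalCensus.slope d q - (fun k : Fin (4 * K - 7 + 1) => Xg K d k) j.castSucc) <
        ∑ i, vg K d (q.1 i) i (q.2 i) := by
  have hx : ((q.2 0 : Fin K) : ℕ) < K := (q.2 0).isLt
  have hy : ((q.2 1 : Fin K) : ℕ) < K := (q.2 1).isLt
  set x := ((q.2 0 : Fin K) : ℕ) with hxdef
  set y := ((q.2 1 : Fin K) : ℕ) with hydef
  rcases perm_two q.1 with hσ | hσ
  · -- identity term: on the staircase it would be a chain term
    have hne1 : y ≠ x := by
      intro hyx
      rcases Nat.lt_or_ge 0 x with hx0 | hx0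
      · by_cases hxt : x + 1 = K
        · refine hch ⟨4 * K - 7, by omega⟩ (eq_termg hK q (4 * K - 7) le_rfl ?_ ?_ ?_)
          · rw [hσ]; exact (permg_id (cls_late2 hK).2.2).symm
          · rw [← hxdef, (cls_late2 hK).1]; omega
          · rw [← hydef, (cls_late2 hK).2.1]; omega
        · refine hch ⟨3 * x - 1, by omega⟩ (eq_termg hK q (3 * x - 1) (by omega) ?_ ?_ ?_)
          · rw [hσ]; exact (permg_id (cls_id2 (K := K) (by omega) (by omega)).2.2).symm
          · rw [← hxdef, (cls_id2 (K := K) (by omega) (by omega)).1]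
          · rw [← hydef, (cls_id2 (K := K) (show 1 ≤ x by omega) (by omega)).2.1]; omega
      · refine hch ⟨0, by omega⟩ (eq_termg hK q 0 (by omega) ?_ ?_ ?_)
        · rw [hσ]; exact (permg_id (cls_zero hK).2.2).symm
        · rw [← hxdef, (cls_zero hK).1]; omega
        · rw [← hydef, (cls_zero hK).2.1]; omega
    have hne2 : y ≠ x + 1 := by
      intro hyx
      by_cases hyt : y + 1 = K
      · refine hch ⟨4 * K - 8, by omega⟩ (eq_termg hK q (4 * K - 8) (by omega) ?_ ?_ ?_)
        · rw [hσ]; exact (permg_id (cls_late1 hK).2.2).symm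
        · rw [← hxdef, (cls_late1 hK).1]; omega
        · rw [← hydef, (cls_late1 hK).2.1]; omega
      · refine hch ⟨3 * y - 2, by omega⟩ (eq_termg hK q (3 * y - 2) (by omega) ?_ ?_ ?_)
        · rw [hσ]; exact (permg_id (cls_id1 (K := K) (by omega) (by omega)).2.2).symm
        · rw [← hxdef, (cls_id1 (K := K) (show 1 ≤ y by omega) (by omega)).1]; omega
        · rw [← hydef, (cls_id1 (K := K) (show 1 ≤ y by omega) (by omega)).2.1]
    rcases Nat.lt_or_ge y x with hlt | hge
    · exact off_id_down hK hd x y (by omega) (by omega) q hσ rfl rfl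
    · exact off_id_up hK hd x y (by omega) (by omega) q hσ rfl rfl
  · -- transposition term: present ⇒ `x ≤ K − 3`, `y ≥ 2`; with `x = 0` or `y = K − 1` it would be a chain term
    rw [termSigng_swap q hσ, εg_10, εg_01] at hq
    have hxK3 : x + 3 ≤ K := by
      by_contra hcon; apply hq; rw [← hxdef, if_neg hcon]; ring
    have hy2 : 2 ≤ y := by
      by_contra hcon; apply hq; rw [← hydef, if_neg hcon]; ring
    have hx1 : 1 ≤ x := by
      by_contra h0
      have hx0 : x = 0 := by omega
      by_cases hyt : y + 1 = K
      · refine hch ⟨3 * K - 6 + 0, by omega⟩ (eq_termg hK q (3 * K - 6 + 0) (by omega) ?_ ?_ ?_)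
        · rw [hσ]; exact (permg_sw (cls_sw_late hK (i := 0) (by omega)).2.2).symm
        · rw [← hxdef, hx0]; exact ((cls_sw_late hK (i := 0) (by omega)).1).symm
        · rw [← hydef, (cls_sw_late hK (i := 0) (by omega)).2.1]; omega
      · refine hch ⟨3 * y - 3, by omega⟩ (eq_termg hK q (3 * y - 3) (by omega) ?_ ?_ ?_)
        · rw [hσ]; exact (permg_sw (cls_sw_early (K := K) hy2 (by omega)).2.2).symm
        · rw [← hxdef, hx0]; exact ((cls_sw_early (K := K) hy2 (by omega)).1).symm
        · rw [← hydef]; exact ((cls_sw_early (K := K) hy2 (by omega)).2.1).symm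
    have hyK2 : y + 2 ≤ K := by
      by_contra h
      have hyt : y = K - 1 := by omega
      refine hch ⟨3 * K - 6 + x, by omega⟩ (eq_termg hK q (3 * K - 6 + x) (by omega) ?_ ?_ ?_)
      · rw [hσ]; exact (permg_sw (cls_sw_late hK hxK3).2.2).symm
      · rw [← hxdef]; exact ((cls_sw_late hK hxK3).1).symm
      · rw [← hydef, hyt]; exact ((cls_sw_late hK hxK3).2.1).symm
    exact off_swapg hK hd x y hx1 hxK3 hy2 hyK2 q hσ rfl rfl

end offchain

/-! ## 8. The general chain on every 2-tower: `T(2, K; d) = 4K − 7` -/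

/-- ★ **THE GENERAL `m = 2` TROPICAL OPTIMUM `4K − 7` IS ATTAINED ON EVERY 2-TOWER** (`K ≥ 3`): a `2 × 2` dominance design on the
2-tower `d` with `4K − 7` sign-alternating uniquely dominant breakpoints at strictly increasing integer slopes (the tree's ceiling
`tropRootLawAt_two_sharp : T(2,K) ≤ 4K − 7` holds on every support). [this work] -/
theorem exists_chain (hK : 3 ≤ K) (d : Fin K → ℕ) (hd : ∀ l l' : Fin K, l < l' → 2 * d l < d l') :
    ∃ (v ε : Fin 2 → Fin 2 → Fin K → ℤ), (∀ i j l, (ε i j l).natAbs ≤ 1) ∧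
      ∃ (θ : Fin (4 * K - 7 + 1) → ℤ) (p : Fin (4 * K - 7 + 1) → Equiv.Perm (Fin 2) × (Fin 2 → Fin K)),
        StrictMono θ ∧ (∀ k, IsDominant d v ε (θ k) (p k)) ∧
        (∀ k : Fin (4 * K - 7), termSign ε (p k.castSucc) * termSign ε (p k.succ) < 0) := by
  obtain ⟨θ, hθ, hdom⟩ := isDominant_of_envelope d (vg K d) (εg K) (termg K hK)
    (fun k => Xg K d k) (fun k => Cg K d k) (fun k => (4 : ℤ) ^ (k : ℕ))
    (slope_termg hK d) (cost_termg hK d)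
    (by
      rw [Fin.strictMono_iff_lt_succ]; intro k
      simp only [Fin.val_succ, Fin.val_castSucc]
      exact Xg_lt_succ hd hK (by have := k.isLt; omega))
    (by
      intro k; simp only [Fin.val_succ, Fin.val_castSucc, pow_succ]
      have : (1 : ℤ) ≤ 4 ^ (k : ℕ) := one_le_pow₀ (by norm_num)
      linarith)
    (by intro k; simp only [Fin.val_succ, Fin.val_castSucc]; exact Cg_succ _)
    (termSign_termg_ne_zero hK) (off_chaing hK hd)
  exact ⟨vg K d, εg K, εg_natAbs, θ, termg K hK, hθ, hdom, alt_termg hK⟩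

/-- ★ **a general real `2 × 2` pencil with `4K − 7` positive determinant zeros on every 2-tower** (Viro patchworking of `exists_chain`,
`le_card_posRoots_patch`; the letters need not be symmetric). [this work] -/
theorem exists_pencil_card_ge (hK : 3 ≤ K) (d : Fin K → ℕ) (hd : ∀ l l' : Fin K, l < l' → 2 * d l < d l') :
    ∃ T : Fin K → Matrix (Fin 2) (Fin 2) ℝ,
      4 * K - 7 ≤ ((∑ l, (Polynomial.X : Polynomial ℝ) ^ d l • (T l).map Polynomial.C).det.roots.toFinset.filter
        (fun t => 0 < t)).card := by
  obtain ⟨v, ε, hε, θ, p, hθ, hdom, halt⟩ := exists_chain hK d hd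
  exact le_card_posRoots_patch d v ε hε θ hθ p hdom halt

/-- ★★ **towers are extremal for the general `m = 2` tropical row, in census currency**: by the tree's real doubling
(`[[0, P], [Pᵀ, 0]]`, `…GeneralDesignDoubling` / `RealDoubling`) one would also get symmetric `4 × 4` floors; here we record the
support-level tropical statement: the chain refutes every budget below `4K − 7` for the dominance-design row ON the tower `d`
(compare the tree's format-level `TwoRowFamily.tropRootLawAt_two_iff`). [this work] -/
theorem not_tropRow_below_on_tower (hK : 3 ≤ K) (d : Fin K → ℕ) (hd : ∀ l l' : Fin K, l < l' → 2 * d l < d l') {B : ℕ}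
    (hB : B < 4 * K - 7) :
    ¬ (∀ (v ε : Fin 2 → Fin 2 → Fin K → ℤ) (n : ℕ) (θ : Fin (n + 1) → ℤ)
        (p : Fin (n + 1) → Equiv.Perm (Fin 2) × (Fin 2 → Fin K)),
        (∀ i j l, (ε i j l).natAbs ≤ 1) → StrictMono θ → (∀ k, IsDominant d v ε (θ k) (p k)) →
        (∀ k : Fin n, termSign ε (p k.castSucc) * termSign ε (p k.succ) < 0) → n ≤ B) := by
  intro h
  obtain ⟨v, ε, hε, θ, p, hθ, hdom, halt⟩ := exists_chain hK d hd
  have := h v ε (4 * K - 7) θ p hε hθ hdom halt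
  omega
end TowerRowTwoGen

end Summit.ValiantsHypothesis.ValiantsHypothesis.Theorems.KPlusLogSqLaw.TowerGraft
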